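import Mathlib
import Literature.AlgebraicGeometry.Resolution.CobordantGame
import Literature.AlgebraicGeometry.Resolution.CobordantChartCoefficients
import Summits.ResolutionOfSingularities.ResolutionOfSingularities.Theorems.WeightedInvariantLocalWeightedDropArrangementDoublePoint

/-!
# `WeightedInvariant.LocalWeightedDrop`: the specimen `y² + x₀x₁x₂(x₀+x₁+x₂)` with ARBITRARY higher-order tail is won (characteristic 2)

Crux item stmt-ResolutionOfSingularities-8899 `LocalWeightedDrop`, skeleton v31, residual stub W4|₄ `stub_wildWideApexFourStartsWon` (`d = 2`).
[OURS · L1 W4.3, chain w43, stub worker 4 (gen 4): the specimen `arrangementDoublePoint_won` upgraded to an infinite family; NOT a statement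
of any manuscript.]

`arrangementDoublePoint_add_won`: over an algebraically closed field of characteristic `2`, EVERY germ
`y² + x₀x₁x₂(x₀+x₁+x₂) + R` with `R` of `(1,1,1,2)`-weighted order `≥ 5` is won.  Same move `(1,1,1,2)`: the tail contributes `s · R″` to the
saturated successor, which touches neither the `Y²`-coefficient, nor the constant term, nor the cross coefficients `[x_i' x_j']` (all read at
exponents without `s`), so the specimen's argument (`ArrangementDoublePoint.coeff_cross_fourLinFactors` + `won_five_of_crossCoeff_ne_zero`) runs
verbatim.
-/

set_option linter.dupNamespace false -- mandated namespace of this single-conjunct summit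

namespace Summit.ResolutionOfSingularities.ResolutionOfSingularities.Theorems

open Literature.AlgebraicGeometry.Resolution
open Literature.AlgebraicGeometry.Resolution.CobordantGame

namespace ArrangementDoublePoint

open MvPowerSeries

variable {k : Type} [Field k]

/-- Divisibility of the chart transform by `s^n` below the weighted order. -/
theorem exists_eq_X_pow_mul_of_le_weightedOrder {N : ℕ} (w : Fin N → ℕ) (c : Fin N → k) (hc : ∀ i, w i = 0 → c i = 0)
    (R : MvPowerSeries (Fin N) k) (n : ℕ) (hn : (n : ℕ∞) ≤ R.weightedOrder w) :
    ∃ R' : MvPowerSeries (Fin (N + 1)) k, subst (CobordantChart.chart w c) R = X 0 ^ n * R' := by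
  have hdvd : (X 0 : MvPowerSeries (Fin (N + 1)) k) ^ n ∣ subst (CobordantChart.chart w c) R := by
    rw [X_pow_dvd_iff]
    intro E hE
    rw [← Finsupp.cons_tail E]
    exact CobordantChart.coeff_subst_chart_eq_zero_of_lt w c hc R (lt_of_lt_of_le (by exact_mod_cast hE) hn) _
  obtain ⟨R', hR'⟩ := hdvd
  exact ⟨R', hR'⟩

/-- Coefficients of `s · R″` at exponents without `s` vanish. -/
theorem coeff_X_zero_mul_eq_zero {N : ℕ} {E : Fin (N + 1) →₀ ℕ} (hE : E 0 = 0) (R : MvPowerSeries (Fin (N + 1)) k) :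
    coeff E (X 0 * R) = 0 :=
  coeff_X_mul_of_apply_eq_zero 0 hE R

end ArrangementDoublePoint

open ArrangementDoublePoint MvPowerSeries in
/-- **THE FAMILY `y² + x₀x₁x₂(x₀+x₁+x₂) + R` IS WON** (`k` algebraically closed of characteristic `2`, `R` any power series of
`(1,1,1,2)`-weighted order `≥ 5`): the move `(1,1,1,2)` and the cross-coefficient exit of `arrangementDoublePoint_won`, the tail riding along
as `s · R″`. [OURS · L1 W4.3 · W4|₄ ∩ {d = 2}, a won family beyond the terminal and semi-quasihomogeneous layers] -/
theorem arrangementDoublePoint_add_won (k : Type) [Field k] [CharP k 2] [IsAlgClosed k] (R : MvPowerSeries (Fin 4) k)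
    (hR : ((5 : ℕ) : ℕ∞) ≤ R.weightedOrder (Fin.insertNth (α := fun _ => ℕ) (Fin.last 3) 2 (fun _ => 1))) :
    CobordantGame.Won k 4 (X (Fin.last 3) ^ 2 + rename (Fin.succAboveEmb (Fin.last 3))
      (X 0 * X 1 * X 2 * (X 0 + X 1 + X 2) : MvPowerSeries (Fin 3) k) + R) := by
  classical
  set Wt : Fin 4 → ℕ := Fin.insertNth (α := fun _ => ℕ) (Fin.last 3) 2 (fun _ => 1) with hWtdef
  set P : MvPowerSeries (Fin 4) k := X (Fin.last 3) ^ 2 + rename (Fin.succAboveEmb (Fin.last 3))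
    (X 0 * X 1 * X 2 * (X 0 + X 1 + X 2) : MvPowerSeries (Fin 3) k) with hP
  have hWtlast : Wt (Fin.last 3) = 2 := by rw [hWtdef, Fin.insertNth_apply_same]
  have hWtcast : ∀ i, Wt (Fin.castSucc i) = 1 := fun i => by rw [hWtdef, ← Fin.succAbove_last, Fin.insertNth_apply_succAbove]
  have hWtpos : ∀ l, 0 < Wt l := fun l => by
    rcases Fin.eq_castSucc_or_eq_last l with ⟨i, rfl⟩ | rfl
    · rw [hWtcast]; exact one_pos
    · rw [hWtlast]; exact two_pos
  have hmove : IsMove k (X : Fin 4 → MvPowerSeries (Fin 4) k) Wt := by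
    refine ⟨fun l => constantCoeff_X l, ?_, ⟨Fin.last 3, by rw [hWtlast]; exact two_pos⟩⟩
    rw [← FormalCoordChange.linSubst_one, ConeDichotomy.linMat_linSubst, Matrix.det_one]
    exact isUnit_one
  refine Won.move X Wt hmove fun g hg => ?_
  have hgS : CobordantGame.IsSingular k g := hg.isSingular
  obtain ⟨pt, a, ⟨l, hWl, hptl⟩, hfac, hndvd, hsing⟩ := hg
  have hself : subst (X : Fin 4 → MvPowerSeries (Fin 4) k) (P + R) = P + R := by
    rw [subst_self]; rfl
  rw [hself] at hfac
  -- the chart and the tail `R ∘ chart = s⁵ · R″`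
  have hcc : cruxChart k Wt pt = CobordantChart.chart Wt pt := by
    have h := CobordantChart.cruxChart_eq_chart (k := k) Wt pt
    have hpt : (fun i => if 0 < Wt i then pt i else 0) = pt := funext fun i => if_pos (hWtpos i)
    rw [hpt] at h
    exact h
  have hs := hasSubst_of_constantCoeff_zero (constantCoeff_cruxChart (k := k) Wt pt)
  obtain ⟨R'', hR''⟩ := exists_eq_X_pow_mul_of_le_weightedOrder Wt pt (fun i hi => absurd hi (hWtpos i).ne') R 5 hR
  set γ : k := pt (Fin.last 3) with hγ
  set c : Fin 3 → k := fun i => pt (Fin.castSucc i) with hc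
  set B : MvPowerSeries (Fin 4) k := (C (c 0) + X (Fin.succ 0)) * (C (c 1) + X (Fin.succ 1)) * (C (c 2) + X (Fin.succ 2)) *
    (C (c 0 + c 1 + c 2) + X (Fin.succ 0) + X (Fin.succ 1) + X (Fin.succ 2)) with hB
  set Q : MvPowerSeries (Fin 5) k := (C γ + X (Fin.last 4)) ^ 2 + rename (Fin.succAboveEmb (Fin.last 4)) B + X 0 * R'' with hQ
  have hTP : subst (cruxChart k Wt pt) P = X 0 ^ 4 * ((C γ + X (Fin.last 4)) ^ 2 + rename (Fin.succAboveEmb (Fin.last 4)) B) :=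
    transform_specimen pt
  have hT : subst (cruxChart k Wt pt) (P + R) = X 0 ^ 4 * Q := by
    rw [← coe_substAlgHom hs, map_add, coe_substAlgHom, hTP, hcc, hR'', hQ]
    ring
  -- `s ∤ Q`: the `Y²` coefficient is `1`
  have hndvd₀ : ¬ X 0 ∣ Q := by
    intro h
    have h1 := (X_dvd_iff.mp h) (Finsupp.single (Fin.last 4) 2) (by rw [Finsupp.single_apply, if_neg Fin.last_pos.ne'])
    rw [hQ, map_add, map_add, MultiplicityLift.coeff_single_rename_eq_zero B two_ne_zero, add_zero,
      coeff_X_zero_mul_eq_zero (by rw [Finsupp.single_apply, if_neg Fin.last_pos.ne']), add_zero,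
      ← one_mul ((C γ + X (Fin.last 4)) ^ 2), ← map_one C, MultiplicityLift.coeff_single_C_mul_add_pow] at h1
    simp at h1
  rw [hT] at hfac
  obtain ⟨-, hgg⟩ := X_pow_mul_eq_X_pow_mul 0 hfac hndvd₀ hndvd
  subst hgg
  by_cases hc0 : ∀ i, c i = 0
  · exfalso
    have hγ0 : γ ≠ 0 := by
      rcases Fin.eq_castSucc_or_eq_last l with ⟨i, rfl⟩ | h
      · exact absurd (hc0 i) hptl
      · rw [hγ, ← h]; exact hptl
    have h00 := hsing.1
    have hX0R : constantCoeff (X 0 * R'' : MvPowerSeries (Fin 5) k) = 0 := by rw [map_mul, constantCoeff_X, zero_mul]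
    rw [hQ, map_add, map_add, TerminalDoublePointDim.constantCoeff_C_add_X_sq, constantCoeff_rename, hX0R, add_zero, hB] at h00
    simp only [map_mul, map_add, constantCoeff_C, constantCoeff_X, add_zero, hc0 0, zero_mul] at h00
    exact hγ0 (pow_eq_zero_iff two_ne_zero |>.mp h00)
  · push Not at hc0
    obtain ⟨i₀, hi₀⟩ := hc0
    have h2 : (2 : k) = 0 := CharTwo.two_eq_zero
    have he0 : ∀ u : Fin 3, (Fin.succAboveEmb (Fin.last 4)) u.succ ≠ 0 := fun u => by
      rw [Fin.coe_succAboveEmb, Fin.succAbove_last]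
      exact Fin.castSucc_ne_zero_iff.mpr (Fin.succ_ne_zero u)
    have hcross : ∀ u v : Fin 3, coeff (Finsupp.single (Fin.succAboveEmb (Fin.last 4) u.succ) 1 +
        Finsupp.single (Fin.succAboveEmb (Fin.last 4) v.succ) 1) Q =
        coeff (Finsupp.single u.succ 1 + Finsupp.single v.succ 1) B := by
      intro u v
      rw [hQ, map_add, map_add, coeff_pair_C_add_X_sq_of_ne γ (Fin.succAboveEmb (Fin.last 4) u.succ) (Fin.succAboveEmb (Fin.last 4) v.succ)
          (by rw [Fin.coe_succAboveEmb]; exact Fin.succAbove_ne _ _) (by rw [Fin.coe_succAboveEmb]; exact Fin.succAbove_ne _ _),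
        zero_add, coeff_X_zero_mul_eq_zero (by
          rw [Finsupp.add_apply, Finsupp.single_apply, Finsupp.single_apply, if_neg (he0 u), if_neg (he0 v), add_zero]),
        add_zero, ← Finsupp.embDomain_single, ← Finsupp.embDomain_single, ← Finsupp.embDomain_add, coeff_embDomain_rename]
    have hne : ∀ u v : Fin 3, u ≠ v → (Fin.succAboveEmb (Fin.last 4)) u.succ ≠ (Fin.succAboveEmb (Fin.last 4)) v.succ :=
      fun u v huv h => huv (Fin.succ_injective _ ((Fin.succAboveEmb (Fin.last 4)).injective h))
    have h01 : (Fin.succ (0 : Fin 3) : Fin 4) ≠ Fin.succ 1 := by decide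
    have h02 : (Fin.succ (0 : Fin 3) : Fin 4) ≠ Fin.succ 2 := by decide
    have h12 : (Fin.succ (1 : Fin 3) : Fin 4) ≠ Fin.succ 2 := by decide
    fin_cases i₀
    · refine won_five_of_crossCoeff_ne_zero _ hgS (hne 1 2 (by decide)) ?_
      rw [hcross, hB, show ((C (c 0) + X (Fin.succ 0)) * (C (c 1) + X (Fin.succ 1)) * (C (c 2) + X (Fin.succ 2)) *
          (C (c 0 + c 1 + c 2) + X (Fin.succ 0) + X (Fin.succ 1) + X (Fin.succ 2)) : MvPowerSeries (Fin 4) k) =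
          (C (c 1) + X (Fin.succ 1)) * (C (c 2) + X (Fin.succ 2)) * (C (c 0) + X (Fin.succ 0)) *
          (C (c 0 + c 1 + c 2) + X (Fin.succ 1) + X (Fin.succ 2) + X (Fin.succ 0)) by ring,
        coeff_cross_fourLinFactors _ _ _ _ h12 (Ne.symm h01) (Ne.symm h02)]
      have : c 0 * (c 1 + c 2 + (c 0 + c 1 + c 2)) = c 0 ^ 2 := by linear_combination (c 0 * (c 1 + c 2)) * h2
      rw [this]
      exact pow_ne_zero 2 hi₀
    · refine won_five_of_crossCoeff_ne_zero _ hgS (hne 0 2 (by decide)) ?_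
      rw [hcross, hB, show ((C (c 0) + X (Fin.succ 0)) * (C (c 1) + X (Fin.succ 1)) * (C (c 2) + X (Fin.succ 2)) *
          (C (c 0 + c 1 + c 2) + X (Fin.succ 0) + X (Fin.succ 1) + X (Fin.succ 2)) : MvPowerSeries (Fin 4) k) =
          (C (c 0) + X (Fin.succ 0)) * (C (c 2) + X (Fin.succ 2)) * (C (c 1) + X (Fin.succ 1)) *
          (C (c 0 + c 1 + c 2) + X (Fin.succ 0) + X (Fin.succ 2) + X (Fin.succ 1)) by ring,
        coeff_cross_fourLinFactors _ _ _ _ h02 h01 (Ne.symm h12)]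
      have : c 1 * (c 0 + c 2 + (c 0 + c 1 + c 2)) = c 1 ^ 2 := by linear_combination (c 1 * (c 0 + c 2)) * h2
      rw [this]
      exact pow_ne_zero 2 hi₀
    · refine won_five_of_crossCoeff_ne_zero _ hgS (hne 0 1 (by decide)) ?_
      rw [hcross, hB, coeff_cross_fourLinFactors _ _ _ _ h01 h02 h12]
      have : c 2 * (c 0 + c 1 + (c 0 + c 1 + c 2)) = c 2 ^ 2 := by linear_combination (c 2 * (c 0 + c 1)) * h2
      rw [this]
      exact pow_ne_zero 2 hi₀
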